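import Summits.CriticalPhenomena.Ising3DConformalLimit.Theorems.ArmDressingArmDressingGlueInvDefs
import Summits.CriticalPhenomena.Ising3DConformalLimit.Theorems.ArmDressingArmDressingGlueInvSystems
import Summits.CriticalPhenomena.Ising3DConformalLimit.Theorems.InversionUpgradeNormalised.Negative.ScaleZeroDressing
import HarnessLib

/-!
# Crux `ArmDressingGlue` (stmt-CriticalPhenomena-15700), stub 3' — part 3: scaling of the mesoscopic one-arm
# ratio `w`

Camia–Feng §3.2.3 transposed, the weight: if the critical correlators renormalised by `ρ₁` converge to a
non-degenerate scale-covariant `S` (dimension `Δ`), then EVERY witness `w` of the one-point clause (ii) of crux C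
(`COne w`: `w η = lim_{η'} lim_δ P[B̄(cᵢ(η'), rᵢ(η')) ↔ B(0,1)ᶜ]/P[… ↔ B(0,η)ᶜ]`) scales like the one-arm
probability: `w(ηκ)/w(η) → κ^Δ` as `η → 0⁺` (`tendsto_COne_ratio`).

Proof.  Apply crux C at `n = 1` to the system `Σ₁ = (c = 0, r = 1, z = 0, a = 1)` and to its EXACT DILATE
`κΣ₁ = (0, κ, 0, κ)`: (a) by C(i), `v₁(0) = lim arm1(δ,1)/arm1(δ,1) = 1` and `v₁'(0) = lim arm1(δ,κ)/arm1(δ,1) =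
lim arm1(δ/κ,1)/arm1(δ,1) = κ^{-Δ}` (`arm1_dilate`, `tendsto_arm1_ratio`); (b) the lattice ratios defining the
witnesses `W, W'` of the two systems agree after `δ ↦ δ/κ` (`fam_dilate`), so `W' = W` eventually
(`cFam_dilate_eventuallyEq`), and any two `COne` witnesses agree eventually (`cOne_eventuallyEq`); (c) hence
`W(η)/w(η) → 1` and `W(η)/w(ηκ) → κ^{-Δ}`, and the quotient gives `w(ηκ)/w(η) → κ^Δ`.

Registered bookkeeping stub proved here: `stub_invWScaling`.  No definitions, no named facts, no sorry.

Reference: F. Camia, Y. Feng, arXiv:2411.01467, Lemma 17 and §3.2.3 (terms `T₃`, `T₄`).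
-/

noncomputable section

namespace Summit.CriticalPhenomena.Ising3DConformalLimit.Cruxes.ArmDressingGlue.InvBook

open scoped BigOperators Topology
open Filter Set Metric
open Literature.Probability.LatticeModels Literature.Probability.Percolation
open Literature.Barriers.CriticalPhenomena
open Summit.CriticalPhenomena.Ising3DConformalLimit.Theses
open Summit.CriticalPhenomena.Ising3DConformalLimit.Cruxes.ArmDressingGlue.Vocab

/-! ### Uniqueness bookkeeping for eventually-defined limits -/

/-- Two eventually-valid limit assignments of the same family agree eventually. [folklore] -/
theorem eventuallyEq_of_tendsto {ι : Type*} {F : Filter ℝ} {G : Filter ι} [G.NeBot] {g : ℝ → ι → ℝ}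
    {Λ Λ' : ℝ → ℝ} (h : ∀ᶠ η in F, Tendsto (g η) G (𝓝 (Λ η)))
    (h' : ∀ᶠ η in F, Tendsto (g η) G (𝓝 (Λ' η))) : Λ =ᶠ[F] Λ' := by
  filter_upwards [h, h'] with η hη hη'
  exact tendsto_nhds_unique hη hη'

/-- Any two witnesses of the one-point clause of crux C agree near `0⁺`. [cite: CamiaFeng2025, Lemma 15] -/
theorem cOne_eventuallyEq {w w' : ℝ → ℝ} (hw : COne w) (hw' : COne w') : w =ᶠ[𝓝[>] 0] w' := by
  -- the centred inner family `B̄(0, η')`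
  have hadm : ∀ᶠ η' in 𝓝[>] (0:ℝ), 0 < η' ∧
      (0 : EuclideanSpace ℝ (Fin 3)) ∈ ball (0 : EuclideanSpace ℝ (Fin 3)) (η' / 2) := by
    filter_upwards [self_mem_nhdsWithin] with η hη using ⟨hη, mem_ball_self (half_pos hη)⟩
  have h1 := hw (fun _ => 0) (fun η => η) (tendsto_nhdsWithin_of_tendsto_nhds tendsto_id) hadm
  have h2 := hw' (fun _ => 0) (fun η => η) (tendsto_nhdsWithin_of_tendsto_nhds tendsto_id) hadm
  filter_upwards [h1, h2] with η hη hη'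
  obtain ⟨Λ, hΛ, hΛw⟩ := hη
  obtain ⟨Λ', hΛ', hΛw'⟩ := hη'
  exact tendsto_nhds_unique (hΛw.congr' (eventuallyEq_of_tendsto hΛ hΛ')) hΛw'

/-- **Dilation transfer for the `CFam` witnesses**: the witness `W'` of the exact dilate
`κΣ = (κc, κr, κz, κa)` of a system `Σ = (c, r, z, a)` agrees with the witness `W` of `Σ` near `0⁺`
(the defining lattice ratios coincide after `δ ↦ δ/κ`). [cite: CamiaFeng2025, §3.2.3] -/
theorem cFam_dilate_eventuallyEq {n : ℕ} {c z : Fin n → EuclideanSpace ℝ (Fin 3)} {r a : Fin n → ℝ}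
    {W W' : ℝ → ℝ} {κ : ℝ} (hκ : 0 < κ) (hW : CFam n c r z a W)
    (hW' : CFam n (fun j => κ • c j) (fun j => κ * r j) (fun j => κ • z j) (fun j => κ * a j) W') :
    W' =ᶠ[𝓝[>] 0] W := by
  -- the centred inner families `B̄(z_j, η')` and `B̄(κ z_j, κ η')`
  have h1 := hW (fun _ j => z j) (fun η _ => η) (fun _ => tendsto_nhdsWithin_of_tendsto_nhds tendsto_id)
    (by filter_upwards [self_mem_nhdsWithin] with η hη j using ⟨hη, mem_ball_self (half_pos hη)⟩)
  have hκt : Tendsto (fun η : ℝ => κ * η) (𝓝[>] (0:ℝ)) (𝓝 0) := by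
    have : Tendsto (fun η : ℝ => κ * η) (𝓝 (0:ℝ)) (𝓝 (κ * 0)) := tendsto_const_nhds.mul tendsto_id
    rw [mul_zero] at this
    exact this.mono_left nhdsWithin_le_nhds
  have h2 := hW' (fun _ j => κ • z j) (fun η _ => κ * η) (fun _ => hκt)
    (by
      filter_upwards [self_mem_nhdsWithin] with η hη j
      exact ⟨mul_pos hκ hη, mem_ball_self (half_pos (mul_pos hκ hη))⟩)
  filter_upwards [h1, h2, self_mem_nhdsWithin] with η hη hη' hη0
  obtain ⟨Λ, hΛ, hΛW⟩ := hη
  obtain ⟨Λ', hΛ', hΛW'⟩ := hη'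
  refine tendsto_nhds_unique (hΛW'.congr' ?_) hΛW
  filter_upwards [hΛ, hΛ'] with η' h h'
  -- the dilated ratio is the original ratio at mesh `δ/κ`
  have hcomp := h.comp (tendsto_div_const_nhdsGT hκ)
  refine tendsto_nhds_unique h' (hcomp.congr fun δ => ?_)
  simp only [Function.comp_apply]
  have hmid : (fun j => (ball (κ • z j) (η * (κ * a j)))ᶜ) =
      fun j => (ball (κ • z j) (κ * (η * a j)))ᶜ := by
    funext j; rw [mul_left_comm]
  rw [hmid, fam_dilate hκ δ z (fun _ => η') c r, fam_dilate hκ δ z (fun _ => η') z (fun j => η * a j)]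

/-! ### Crux C at `n = 1` around the origin: the ratio is the one-arm probability -/

/-- `CROSS 1` is the single relation `R 0 1`. [folklore] -/
theorem cross_one : CROSS 1 = {R : Fin 2 → Fin 2 → Prop | R 0 1} := by
  ext R
  simp only [CROSS, mem_setOf_eq, Fin.forall_fin_one]
  exact Iff.rfl

/-- The point probe of the origin is `{0}`. [folklore] -/
theorem pts_one_zero (δ : ℝ) : pts 1 δ (fun _ => (0 : EuclideanSpace ℝ (Fin 3))) = fun _ => {(0 : Site 3)} := by
  funext j
  simp only [pts]
  congr 1
  funext i
  rw [latticeApprox_apply]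
  simp

/-- At `n = 1`, `c = z = 0`: the C(i) probability `P[0^δ ↔ (B(0,R)ᶜ)^δ]` is `arm1 δ R`. [folklore] -/
theorem Pr_append_pts_zero (δ R : ℝ) :
    Pr (1 + 1) (Fin.append (pts 1 δ (fun _ => (0 : EuclideanSpace ℝ (Fin 3))))
      (fun _ => disc δ (ball (0 : EuclideanSpace ℝ (Fin 3)) R)ᶜ)) (CROSS 1) = arm1 δ R := by
  rw [pts_one_zero, cross_one,
    Summit.CriticalPhenomena.Ising3DConformalLimit.InversionUpgradeNormalisedNegative.fin_append_one_one]
  rfl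

/-- The value of a `CArm` witness is the pointwise limit of the C(i) ratio. [folklore] -/
theorem cArm_tendsto_at {n : ℕ} {c : Fin n → EuclideanSpace ℝ (Fin 3)} {r : Fin n → ℝ}
    {v : (Fin n → EuclideanSpace ℝ (Fin 3)) → ℝ} (hv : CArm n c r v) {z : Fin n → EuclideanSpace ℝ (Fin 3)}
    (hz : ∀ j, z j ∈ ball (c j) (r j)) :
    Tendsto (fun δ => Pr (n + n) (Fin.append (pts n δ z) (fun j => disc δ (ball (c j) (r j))ᶜ)) (CROSS n) /
      (arm1 δ 1) ^ n) (𝓝[>] 0) (𝓝 (v z)) :=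
  hv.2.2.tendsto_at hz

/-- At `n = 1`, system `(0, R)`, point `0`: the `CArm` witness is the limit of `arm1(δ,R)/arm1(δ,1)`. [folklore] -/
theorem tendsto_arm1_ratio_of_CArm {R : ℝ} {v : (Fin 1 → EuclideanSpace ℝ (Fin 3)) → ℝ}
    (hv : CArm 1 (fun _ => 0) (fun _ => R) v) (hR : 0 < R) :
    Tendsto (fun δ => arm1 δ R / arm1 δ 1) (𝓝[>] 0) (𝓝 (v fun _ => 0)) := by
  have h := cArm_tendsto_at hv (z := fun _ => 0) (fun _ => mem_ball_self hR)
  refine h.congr fun δ => ?_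
  rw [pow_one, Pr_append_pts_zero]

/-! ### The scaling of `w` -/

/-- **Scaling of the mesoscopic one-arm ratio.**  Given crux C, `arm1 > 0` on `(0,1]`, and a non-degenerate
`ρ₁`-limit `S` that is scale covariant with dimension `Δ`, every witness `w` of the one-point clause of C satisfies
`w(ηκ)/w(η) → κ^Δ` (`η → 0⁺`), for every `κ > 0`. [cite: CamiaFeng2025, Lemma 17 and §3.2.3] -/
theorem tendsto_COne_ratio (hC : ArmDressing.ArmExtensionFactorisation) (hpos : Arm1Pos) {S : CorrFamily 3}
    {Δ : ℝ} (hlim : HasPointwiseScalingLimit (criticalCorr 3) rho1 S) (hnd : IsNondegenerateTwoPoint S)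
    (hsc : IsScaleCovariant Δ S) {w : ℝ → ℝ} (hw : COne w) {κ : ℝ} (hκ : 0 < κ) :
    Tendsto (fun η => w (η * κ) / w η) (𝓝[>] 0) (𝓝 (κ ^ Δ)) := by
  -- crux C at `n = 1` for `Σ₁ = (0, 1, 0, 1)` and its dilate `κΣ₁ = (0, κ, 0, κ)`
  have hdisj : ∀ (ρ : ℝ) (j k : Fin 1), j ≠ k →
      Disjoint (closedBall ((fun _ => (0 : EuclideanSpace ℝ (Fin 3))) j) ((fun _ => ρ) j))
        (closedBall ((fun _ => (0 : EuclideanSpace ℝ (Fin 3))) k) ((fun _ => ρ) k)) :=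
    fun ρ j k hjk => absurd (Subsingleton.elim j k) hjk
  obtain ⟨v₁, hv₁, hW₁⟩ := cArm_extract hC le_rfl (fun _ => (0 : EuclideanSpace ℝ (Fin 3))) (fun _ => (1:ℝ))
    (fun _ => one_pos) (hdisj 1)
  obtain ⟨W, w₁, hW, hw₁, hT⟩ := hW₁ (fun _ => 0) (fun _ => mem_ball_self one_pos) (fun _ => 1)
    (fun _ => one_pos)
  obtain ⟨v₂, hv₂, hW₂⟩ := cArm_extract hC le_rfl (fun _ => (0 : EuclideanSpace ℝ (Fin 3))) (fun _ => κ)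
    (fun _ => hκ) (hdisj κ)
  obtain ⟨W', w₂, hW', hw₂, hT'⟩ := hW₂ (fun _ => 0) (fun _ => mem_ball_self hκ) (fun _ => κ)
    (fun _ => hκ)
  -- (a) the values of the `CArm` witnesses at the origin
  have hv₁0 : v₁ (fun _ => 0) = 1 := by
    have h := tendsto_arm1_ratio_of_CArm hv₁ one_pos
    refine tendsto_nhds_unique h (tendsto_const_nhds.congr' ?_)
    filter_upwards [Ioc_mem_nhdsGT one_pos] with δ hδ
    exact (div_self (hpos δ hδ).ne').symm
  have hv₂0 : v₂ (fun _ => 0) = κ ^ (-Δ) := by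
    have h := tendsto_arm1_ratio_of_CArm hv₂ hκ
    refine tendsto_nhds_unique h ?_
    refine (tendsto_arm1_ratio hpos hlim hnd hsc hκ).congr fun δ => ?_
    rw [arm1_dilate hκ]
  -- (b) the witnesses of the dilate agree with those of `Σ₁`
  have hWW : W' =ᶠ[𝓝[>] 0] W := by
    have h := @cFam_dilate_eventuallyEq 1 (fun _ => (0 : EuclideanSpace ℝ (Fin 3))) (fun _ => 0)
      (fun _ => (1:ℝ)) (fun _ => (1:ℝ)) W W' κ hκ hW
    simp only [smul_zero, mul_one] at h
    exact h hW'
  have hww : w₂ =ᶠ[𝓝[>] 0] w₁ := cOne_eventuallyEq hw₂ hw₁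
  have hww' : ∀ᶠ η in 𝓝[>] (0:ℝ), w₂ (η * κ) = w₁ (η * κ) :=
    (MoebiusLimitExistsNegative.tendsto_const_mul_nhdsGT hκ).eventually hww |>.mono fun η h => by
      rw [mul_comm]; exact h
  -- (c) `W/w₁ → 1` and `W/w₁(·κ) → κ^{-Δ}`
  have hT1 : Tendsto (fun η => W η / w₁ η) (𝓝[>] 0) (𝓝 1) := by
    rw [← hv₁0]
    refine hT.congr fun η => ?_
    rw [Fin.prod_univ_one, mul_one]
  have hT2 : Tendsto (fun η => W η / w₁ (η * κ)) (𝓝[>] 0) (𝓝 (κ ^ (-Δ))) := by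
    rw [← hv₂0]
    refine hT'.congr' ?_
    filter_upwards [hWW, hww'] with η h1 h2
    rw [Fin.prod_univ_one, h1, h2]
  -- eventually all three quantities are non-zero
  have hκΔ : κ ^ (-Δ) ≠ 0 := (Real.rpow_pos_of_pos hκ _).ne'
  have hne1 : ∀ᶠ η in 𝓝[>] (0:ℝ), W η / w₁ η ≠ 0 := hT1.eventually_ne one_ne_zero
  have hne2 : ∀ᶠ η in 𝓝[>] (0:ℝ), W η / w₁ (η * κ) ≠ 0 := hT2.eventually_ne hκΔ
  have hq := hT2.inv₀ hκΔ |>.mul hT1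
  have hval : (κ ^ (-Δ))⁻¹ * 1 = κ ^ Δ := by
    rw [mul_one, Real.rpow_neg hκ.le, inv_inv]
  rw [hval] at hq
  -- the statement for the particular witness `w₁`
  have hmain : Tendsto (fun η => w₁ (η * κ) / w₁ η) (𝓝[>] 0) (𝓝 (κ ^ Δ)) := by
    refine hq.congr' ?_
    filter_upwards [hne1, hne2] with η h1 h2
    have hW0 : W η ≠ 0 := fun h => h1 (by rw [h, zero_div])
    have hw0 : w₁ η ≠ 0 := fun h => h1 (by rw [h, div_zero])
    have hwκ : w₁ (η * κ) ≠ 0 := fun h => h2 (by rw [h, div_zero])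
    rw [inv_div, div_mul_div_comm, mul_comm (w₁ (η * κ)) (W η), mul_div_mul_left _ _ hW0]
  -- transfer to the given witness `w`, which agrees with `w₁` near `0⁺`
  have hw1 : w =ᶠ[𝓝[>] 0] w₁ := cOne_eventuallyEq hw hw₁
  have hw2 : ∀ᶠ η in 𝓝[>] (0:ℝ), w (η * κ) = w₁ (η * κ) :=
    (MoebiusLimitExistsNegative.tendsto_const_mul_nhdsGT hκ).eventually hw1 |>.mono fun η h => by
      rw [mul_comm]; exact h
  refine hmain.congr' ?_
  filter_upwards [hw1, hw2] with η h1 h2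
  rw [h1, h2]

/-- Registered bookkeeping stub `stub_invWScaling` of the skeleton (= `tendsto_COne_ratio`), through which this
file lands. [cite: CamiaFeng2025, Lemma 17] -/
theorem stub_invWScaling : ArmDressing.ArmExtensionFactorisation → Arm1Pos → ∀ (Δ : ℝ) (S : CorrFamily 3), HasPointwiseScalingLimit (criticalCorr 3) rho1 S → IsNondegenerateTwoPoint S → IsScaleCovariant Δ S → ∀ w : ℝ → ℝ, COne w → ∀ κ : ℝ, 0 < κ → Tendsto (fun η => w (η * κ) / w η) (𝓝[>] (0:ℝ)) (𝓝 (κ ^ Δ)) :=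
  fun hC hpos _ _ hlim hnd hsc _ hw _ hκ => tendsto_COne_ratio hC hpos hlim hnd hsc hw hκ

end Summit.CriticalPhenomena.Ising3DConformalLimit.Cruxes.ArmDressingGlue.InvBook

end
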